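import Mathlib
import Summits.ResolutionOfSingularities.ResolutionOfSingularities.Theorems.WeightedInvariantLocalWeightedDropWildPurePowerFlagDefs

/-!
# `WeightedInvariant.LocalWeightedDrop`, line `hasse-ridge-face-selection`, piece S3πM: the ordinal `ω²·d + ω·n + s` of a flag
# triple — monotonicity

Crux item stmt-ResolutionOfSingularities-8899 `LocalWeightedDrop` (route `ResolutionOfSingularities/WeightedInvariant`), serving the
door `WeightedConstruction` stmt-ResolutionOfSingularities-0571.  [OURS · L1 W4.3, chain w43, stub worker 1 (gen 3); bookkeeping for
the measure `PurePowerFlag.measure`; not a statement of any manuscript.]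

`PurePowerFlag.embed (d, n, s) = ω²·d + ω·n + s` (`s = ∞ ↦ ω`) is strictly increasing for the lexicographic order from every triple
with finite `s` (`embed_lt_embed`), monotone everywhere (`embed_le_embed`), and bounded by `ω³`.  This is what turns Hauser–Perlega's
"`inv^𝓖_{a'}(X') < inv^𝓕_a(X)`" (PRIMS 60 (2024) Prop. 4, with `𝓖` maximizing and of finite `s`, Prop. 3) into a strict drop of
the ordinal measure demanded by the descent lift.
-/

set_option linter.dupNamespace false -- mandated namespace of this single-conjunct summit

namespace Summit.ResolutionOfSingularities.ResolutionOfSingularities.Theorems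

open Literature.AlgebraicGeometry.Resolution
open Literature.AlgebraicGeometry.Resolution.HauserPerlega2024

namespace PurePowerFlag

/-! ### The ordinal of a triple -/

section Embed

open Ordinal

/-- The tail `ω·n + s` of the ordinal of a triple is below `ω²`. -/
theorem embed_tail_lt (n : ℕ) (s : ℕ∞) :
    ω * (n : Ordinal) + ((s.toNat : ℕ) : Ordinal) + (if s = ⊤ then ω else 0) < ω ^ (2 : ℕ) := by
  have h1 : ((s.toNat : ℕ) : Ordinal) + (if s = ⊤ then ω else 0) ≤ ω + ω := by
    split_ifs
    · exact add_le_add (le_of_lt (natCast_lt_omega0 _)) le_rfl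
    · rw [add_zero]; exact le_trans (le_of_lt (natCast_lt_omega0 _)) le_self_add
  calc ω * (n : Ordinal) + ((s.toNat : ℕ) : Ordinal) + (if s = ⊤ then ω else 0)
      = ω * (n : Ordinal) + (((s.toNat : ℕ) : Ordinal) + (if s = ⊤ then ω else 0)) := by rw [add_assoc]
    _ ≤ ω * (n : Ordinal) + (ω + ω) := by gcongr
    _ = ω * ((n + 1 + 1 : ℕ) : Ordinal) := by rw [Nat.cast_succ, Nat.cast_succ, mul_add_one, mul_add_one, add_assoc]
    _ < ω * ω := mul_lt_mul_of_pos_left (natCast_lt_omega0 _) omega0_pos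
    _ = ω ^ (2 : ℕ) := (pow_two ω).symm

/-- The ordinal of a triple, unfolded on components. -/
theorem embed_toLex (d n : ℕ) (s : ℕ∞) :
    embed (toLex (d, toLex (n, s))) =
      ω ^ (2 : ℕ) * (d : Ordinal) + ω * (n : Ordinal) + ((s.toNat : ℕ) : Ordinal) + (if s = ⊤ then ω else 0) := rfl

/-- Every ordinal of a triple is below `ω³`. -/
theorem embed_lt_omega_pow_three (v : Triple) : embed v < ω ^ (3 : ℕ) := by
  obtain ⟨d, n, s, rfl⟩ : ∃ d n s, v = toLex (d, toLex (n, s)) :=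
    ⟨(ofLex v).1, (ofLex (ofLex v).2).1, (ofLex (ofLex v).2).2, rfl⟩
  rw [embed_toLex, add_assoc, add_assoc]
  calc ω ^ (2 : ℕ) * (d : Ordinal) + (ω * (n : Ordinal) + (((s.toNat : ℕ) : Ordinal) + (if s = ⊤ then ω else 0)))
      < ω ^ (2 : ℕ) * (d : Ordinal) + ω ^ (2 : ℕ) := by
        refine (add_lt_add_iff_left _).mpr ?_
        rw [← add_assoc]; exact embed_tail_lt n s
    _ = ω ^ (2 : ℕ) * ((d + 1 : ℕ) : Ordinal) := by rw [Nat.cast_succ, mul_add_one]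
    _ < ω ^ (2 : ℕ) * ω := mul_lt_mul_of_pos_left (natCast_lt_omega0 _) (pow_pos omega0_pos _)
    _ = ω ^ (3 : ℕ) := by rw [← pow_succ]

/-- STRICT MONOTONICITY of the ordinal of a triple, from a triple with finite `s`: this is how "`inv^𝓖 < inv^𝓕`" for a
maximizing `𝓖` at the blown-up point (finite `s_𝓖`, [HP24, Prop. 3]) becomes a drop of the measure. -/
theorem embed_lt_embed {v w : Triple} (hvw : v < w) (hs : (ofLex (ofLex v).2).2 ≠ ⊤) : embed v < embed w := by
  obtain ⟨d, n, s, rfl⟩ : ∃ d n s, v = toLex (d, toLex (n, s)) :=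
    ⟨(ofLex v).1, (ofLex (ofLex v).2).1, (ofLex (ofLex v).2).2, rfl⟩
  obtain ⟨d', n', s', rfl⟩ : ∃ d n s, w = toLex (d, toLex (n, s)) :=
    ⟨(ofLex w).1, (ofLex (ofLex w).2).1, (ofLex (ofLex w).2).2, rfl⟩
  change s ≠ ⊤ at hs
  rw [embed_toLex, embed_toLex, if_neg hs, add_zero]
  have htail : ω * (n : Ordinal) + ((s.toNat : ℕ) : Ordinal) < ω ^ (2 : ℕ) := by
    have := embed_tail_lt n s
    rwa [if_neg hs, add_zero] at this
  rcases Prod.Lex.toLex_lt_toLex.mp hvw with hd | ⟨hd, hrest⟩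
  · -- `d < d'`
    calc ω ^ (2 : ℕ) * (d : Ordinal) + ω * (n : Ordinal) + ((s.toNat : ℕ) : Ordinal)
        = ω ^ (2 : ℕ) * (d : Ordinal) + (ω * (n : Ordinal) + ((s.toNat : ℕ) : Ordinal)) := by rw [add_assoc]
      _ < ω ^ (2 : ℕ) * (d : Ordinal) + ω ^ (2 : ℕ) := (add_lt_add_iff_left _).mpr htail
      _ = ω ^ (2 : ℕ) * ((d + 1 : ℕ) : Ordinal) := by rw [Nat.cast_succ, mul_add_one]
      _ ≤ ω ^ (2 : ℕ) * (d' : Ordinal) := by gcongr; exact_mod_cast hd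
      _ ≤ _ := by rw [add_assoc, add_assoc]; exact le_self_add
  · subst hd
    rcases Prod.Lex.toLex_lt_toLex.mp hrest with hn | ⟨hn, hs'⟩
    · -- `n < n'`
      calc ω ^ (2 : ℕ) * (d : Ordinal) + ω * (n : Ordinal) + ((s.toNat : ℕ) : Ordinal)
          < ω ^ (2 : ℕ) * (d : Ordinal) + ω * (n : Ordinal) + ω := (add_lt_add_iff_left _).mpr (natCast_lt_omega0 _)
        _ = ω ^ (2 : ℕ) * (d : Ordinal) + ω * ((n + 1 : ℕ) : Ordinal) := by
            rw [Nat.cast_succ, mul_add_one, add_assoc]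
        _ ≤ ω ^ (2 : ℕ) * (d : Ordinal) + ω * (n' : Ordinal) := by gcongr; exact_mod_cast hn
        _ ≤ ω ^ (2 : ℕ) * (d : Ordinal) + ω * (n' : Ordinal) + (((s'.toNat : ℕ) : Ordinal) + (if s' = ⊤ then ω else 0)) :=
            le_self_add
        _ = _ := by simp only [add_assoc]
    · subst hn
      by_cases hs't : s' = ⊤
      · rw [if_pos hs't]
        calc ω ^ (2 : ℕ) * (d : Ordinal) + ω * (n : Ordinal) + ((s.toNat : ℕ) : Ordinal)
            < ω ^ (2 : ℕ) * (d : Ordinal) + ω * (n : Ordinal) + ω := (add_lt_add_iff_left _).mpr (natCast_lt_omega0 _)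
          _ ≤ ω ^ (2 : ℕ) * (d : Ordinal) + ω * (n : Ordinal) + (((s'.toNat : ℕ) : Ordinal) + ω) := by
              gcongr; exact le_add_self
          _ = _ := by simp only [add_assoc]
      · rw [if_neg hs't, add_zero]
        refine (add_lt_add_iff_left _).mpr ?_
        have h1 : s.toNat < s'.toNat := by
          lift s to ℕ using hs
          lift s' to ℕ using hs't
          simpa using hs'
        exact_mod_cast h1

/-- MONOTONICITY of the ordinal of a triple. -/
theorem embed_le_embed {v w : Triple} (hvw : v ≤ w) : embed v ≤ embed w := by
  rcases hvw.lt_or_eq with hlt | heq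
  · by_cases hs : (ofLex (ofLex v).2).2 = ⊤
    · obtain ⟨d, n, s, rfl⟩ : ∃ d n s, v = toLex (d, toLex (n, s)) :=
        ⟨(ofLex v).1, (ofLex (ofLex v).2).1, (ofLex (ofLex v).2).2, rfl⟩
      obtain ⟨d', n', s', rfl⟩ : ∃ d n s, w = toLex (d, toLex (n, s)) :=
        ⟨(ofLex w).1, (ofLex (ofLex w).2).1, (ofLex (ofLex w).2).2, rfl⟩
      change s = ⊤ at hs
      subst hs
      have hle : toLex (d, toLex (n + 1, (0 : ℕ∞))) ≤ toLex (d', toLex (n', s')) := by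
        rcases Prod.Lex.toLex_lt_toLex.mp hlt with hd | ⟨hd, hrest⟩
        · exact le_of_lt (Prod.Lex.toLex_lt_toLex.mpr (Or.inl hd))
        · subst hd
          rcases Prod.Lex.toLex_lt_toLex.mp hrest with hn | ⟨hn, hs'⟩
          · refine Prod.Lex.toLex_le_toLex.mpr (Or.inr ⟨rfl, ?_⟩)
            rcases (Nat.succ_le_of_lt hn).lt_or_eq with h | h
            · exact le_of_lt (Prod.Lex.toLex_lt_toLex.mpr (Or.inl h))
            · exact Prod.Lex.toLex_le_toLex.mpr (Or.inr ⟨h, zero_le⟩)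
          · exact absurd hs' (not_lt_of_ge le_top)
      have h1 : embed (toLex (d, toLex (n, (⊤ : ℕ∞)))) = embed (toLex (d, toLex (n + 1, (0 : ℕ∞)))) := by
        rw [embed_toLex, embed_toLex, if_pos rfl, if_neg (by exact ENat.coe_ne_top 0)]
        simp only [ENat.toNat_top, Nat.cast_zero, add_zero, Nat.cast_succ, mul_add_one, ENat.toNat_zero, add_assoc]
      rw [h1]
      rcases hle.lt_or_eq with hlt' | heq'
      · exact le_of_lt (embed_lt_embed hlt' (by change ((0 : ℕ) : ℕ∞) ≠ ⊤; exact ENat.coe_ne_top _))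
      · rw [heq']
    · exact le_of_lt (embed_lt_embed hlt hs)
  · rw [heq]

end Embed

end PurePowerFlag

end Summit.ResolutionOfSingularities.ResolutionOfSingularities.Theorems
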